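import Summits.HodgeConjecture.HodgeConjecture.Theorems.F0P6aDatumOfInputsDefs
import Summits.HodgeConjecture.HodgeConjecture.Theorems.F0P6aStubDOWN
import Summits.HodgeConjecture.HodgeConjecture.Theorems.F0P6aStubFROB
import HarnessLib
import HarnessLib.Audit.LibrarySuggestionsDenyListCruxes
/-!
## Import provenance (CANONICAL HEADER — LEAD F0P6-plan (g6) «M-142a» (A): bare `import` lines only; their provenance notes, verbatim)

- `import Summits.HodgeConjecture.HodgeConjecture.Theorems.F0P6aDatumOfInputsDefs` -- ED. 4 (K5-H2): the ★ DEFS TWIN (§0 dock, §0a–§0d letters, §0e `L1Fold` organs; namespace KEPT) — this hub keeps ONLY the sockets + heads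
- `import Summits.HodgeConjecture.HodgeConjecture.Theorems.F0P6aStubDOWN` -- ED. 5 (P): ★ K6 twin of the L2 closer leaf (LAST part = stem): head `F0P6aStubDOWN.stub_DOWN_of_organs` PAYS `stub_DOWN` BY TERM
- `import Summits.HodgeConjecture.HodgeConjecture.Theorems.F0P6aStubFROB` -- ED. 5 (P): ★ K6 twin of the L3 closer leaf (LAST part = stem): head `F0P6aStubFROB.stubFROB_of_parts` PAYS `stub_FROB` BY TERM
- `import HarnessLib.Audit.LibrarySuggestionsDenyListCruxes` -- [ED. 4] build-lane export guard (operator companion, req547; LEAD «M-119b»): deny-list entry "Cruxes" for the LibrarySuggestions export fold — ADD-ONLY carrier on every new `Lines` edition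

# F0 · P6a — THE D-LINE `stub_DATUM := datum_of_line` — HUB ED. 5 «(P) SOCKETS PAID BY TERM» (desk F0P6c-plan (g9) cand v1 over ED. 4 d700f11eb49df78a; written only after K6 wave 3 BUILT + a LEAD numbered cue)

ED. 5 = ED. 4 with EXACTLY: (i) two `import`s added — the ★ K6 twins `Theorems.F0P6aStubDOWN` ∕ `Theorems.F0P6aStubFROB` of the L2 ∕ L3 closer leaves (LAST parts = stems; the `Lines`
leaf ORIGINALS imported THIS hub, so paying the sockets here was an import CYCLE through ED. 4 — whence LEAD «M-81» (2) ∕ «M-92» (2) ∕ «M-120» (S1) «closure host = MAIN by import,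
never paid in this file»; the ★ twins import only ★ `Theorems.F0P6aDatumOfInputsDefs`, so after wave 3 the cycle is gone); (ii) the two socket BODIES `by sorry` → the ★ leaf heads
applied BY TERM (`stub_DOWN := F0P6aStubDOWN.stub_DOWN_of_organs I 𝔡 quotΩ translΩ …`, `stub_FROB := F0P6aStubFROB.stubFROB_of_parts I 𝔡 quotΩ translΩ … 𝔯 …`; junctions of record
leaf :1978 ∕ :516, re-certified by copy `F0/P6/F0P6c-plan/g9/k6r/HubEd5.optionP.socketsPaid.termshape.scratch.v1.F0P6c-plan-g9.lean` 9ba0e575f1d15def rc 0 ∕ e0 ∕ w0 ∕ s0, `--axioms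
datum_of_line_paid` = TRIO); (iii) two junction-docstring parentheticals «the sockets՚ `sorryAx` enters only here» → «sorry-free».  0 statement bytes changed on any declaration;
every FQN kept (`stub_LINES`, `stub_DOWN`, `stub_FROB`, `datum_of_line`, `datum_of_inputs`, all ORDER ∕ JUNCTION certificates), so every importer re-makes unchanged.  Code `sorry` = ∅
(was 2 = {`stub_DOWN`, `stub_FROB`}); `--axioms datum_of_line` = `--axioms stub_DOWN` = `--axioms stub_FROB` = {propext, Classical.choice, Quot.sound}: the D-LINE is CLOSED IN ITS
OWN FILE (LEAD «M-72» (5): «a hub sheds each paid stub by its normal OUT-stub (PAID∕DERIVED) edition and re-homes after its LAST socket closes»).  The ED. 4 sorry-census sentences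
below («Code `sorry` = exactly {`stub_DOWN`, `stub_FROB`}», «`--axioms datum_of_line` = TRIO ∪ {sorryAx …}») are SUPERSEDED by this paragraph and kept for the record.
Count-neutral: MAIN՚s cone is unchanged (★ MAIN `Theorems.F0P6aModuliDatum` reads `datum_of_inputs_star` at the ★ leaf heads; this hub lies outside MAIN՚s closure after the MAIN shim).
HONEST LABEL: HC_CM is proved only modulo the 7 printed citations (2 remaining named inputs hLiu418 = stmt-HodgeConjecture-24832, h413 = stmt-HodgeConjecture-24833) until rung 0 closes.

THE HUB՚S ED. 4 HEADER (verbatim below, for the record — «ED. 4 = ED. 3 with …» and its line numbers refer to ED. 4, whose body this file keeps byte-identical outside (i)–(iii)):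

# F0 · P6a — THE D-LINE `stub_DATUM := datum_of_line` — HUB ED. 4 «K5-H2 DEFS SPLIT» (desk F0P6c-plan (g8) cand v3 over ED. 3 a42642215a80d44d; v4 = v3 after CURE (A) of ★ PART 4՚s dry-run bounce `dedup.landed` 2026-09-02T22:51:14Z: `stub_LINES` (BY TERM over ★ §0e) + its junction STAY HERE by FQN (ED. 3 :750–783 verbatim), only the socket TYPES + `datum_of_inputs_star` ride ★-side (shape (H1b′), LEAD «M-140a» (1)); ORDER∕JUNCTION certificates added here; the «M-119b» carrier import l.3)

HONEST LABEL: HC_CM is proved only modulo the 7 printed citations (2 remaining named inputs hLiu418 = stmt-HodgeConjecture-24832,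
h413 = stmt-HodgeConjecture-24833) until rung 0 closes.  Count-neutral edition: 0 statement bytes, 0 proof bytes changed on any declaration.

ED. 4 = ED. 3 with lines 57–748 (§0 dock, §0a–§0d letters, §0e `namespace L1Fold` organs — all sorry-free) MOVED VERBATIM to the Defs twin imported on line 1
(same namespace ⇒ every FQN unchanged ⇒ 0 downstream bytes: the 13 direct importers keep `import …Lines.F0_P6a_DatumOfInputs` and see the same constants), and
lines 749–1017 (§1 `section Stubs`: `stub_LINES` BY TERM + junction, sockets `stub_DOWN` ∕ `stub_FROB`; §2 head `datum_of_line`; §3 parametric head `datum_of_inputs`;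
junction) KEPT VERBATIM below.  Code `sorry` = exactly {`stub_DOWN`, `stub_FROB`} as in ED. 3 (closed BY NAME in MAIN `Lines/F0_P6a_ModuliDatum.lean` by import of the
L2∕L3 closer leaves — LEAD «M-81» (2) ∕ «M-92» (2) ∕ «M-120» (S1): never paid in this file); `--axioms datum_of_inputs` = {propext, Classical.choice, Quot.sound};
`--axioms datum_of_line` = TRIO ∪ {sorryAx via `stub_DOWN`, `stub_FROB` only}.

THE HUB՚S ED. 3 DOCSTRING (verbatim, for the record — its line numbers refer to ED. 3):

> # F0 · P6a — THE D-LINE `stub_DATUM := datum_of_line`: the moduli datum from the localised PEL inputs, FIELD GROUP BY FIELD GROUP (ED. 1 cand v3, P6c (g4))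
>
> `crux_decl: Summit.HodgeConjecture.HodgeConjecture.Theses.HCCMUnconditional.HLiu418`.  Sub-line of P6a under the spine
> `Lines/F0_P6a_RGDAssembly.lean` ED. 2 (tree 61a434989f165c71, A-p18 (g31), (FD) BUILT 2026-09-01T23:47:35Z), LEAD F0P6-plan (g3) «M-36-pre» (8) 23:22:32Z +
> «M-39» 23:29:14Z (closing topology: this line IMPORTS the spine and is a LEAF; main ED. 7 sets `stub_RGD := rgd_of_… pel_of_line datum_of_line` one level up) +
> GEN heir A-p18 (g31) fork rulings 23:30:03Z (F1 (a) ADM, F2 (b) `DockData` light shape, F3 SP4, F4, Q4 carriers = D-line §0).  HC_CM is proved only modulo the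
> printed citations until rung 0 closes; this file is count-neutral until its stubs close.
>
> HEAD `datum_of_line` has the type of the spine socket `stub_DATUM` (:333) TOKEN FOR TOKEN (`∀ F … θ _hθ e _hunit _hKc _hdisj, RGDInputsAt … → Nonempty (ModuliDatum …)`;
> junction certified by import: `example : type_of% @F0P6aRGDAssembly.stub_DATUM := @datum_of_line`) and is SORRY-FREE over the three named stubs below;
> `--axioms datum_of_line` = {propext, Classical.choice, Quot.sound, sorryAx} through exactly `stub_LINES`, `stub_DOWN`, `stub_FROB`.
>
> THE CUT (memo `F0/P6/F0P6c-plan/g4/MEMO-DLINE-cut.v1.F0P6c-plan-g4.md` 04deaeb71e1797a8, rows G1–G13):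
> * §0 THE DOCK AS DATA (G6, sorry-free; GEN heir (g31) Q2 shape): `DockData k p f A act w` = the 13 data ∕ 11 laws of spine §4 `DockPackage` over P6d՚s light variables
>   (field names = the `BlockReading₀` K-rows), `DockPackage.nonempty_dockData`, the point reading `DockAt I x̄` and `nonempty_dockAt` = spine §4 `blockDock_of_inputs` (fork F2 (b)).
> * §0 CARRIERS BY CONSTRUCTION (G5, fork F1 (a) ADM): `LineOf I y` = the admissible (`𝒪_F`-stable, order `q`, killed by `𝔭_{c•w}`) subgroups of `A_y(Ω)` on the sheet
>   `e` — EXACTLY the codomain of the (L4) bijection `β ↦ H_β`; `SubOf I 𝔡 x̄ := AdmSub (G₀ x̄) (β₀ x̄) q` (★ P6c §1), `kerFOf := ⟨kerFI …, isAdm_kerFI …⟩`, `IsEtaleOf := IdealIsEtale`;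
>   hence `subEquiv := Equiv.refl`, `kerF_spec := rfl`, `isEtale_spec := Iff.rfl` in the head.
> * §0 LETTERS: `HeckeClause` (the `hecke` field type verbatim over `LineOf I`), `RoofLink`∕`RoofLink₂` (the (L4) roofs as properties of the readings `quotΩ`∕`translΩ`),
>   the downstairs interface `SpecReadings` (light rows `sp quot transl red_quotΩ red_translΩ canonicalLine₀ smap smap_kerF quot_smap`) + the named laws `IsogHomLaw`,
>   `IsogKerLaw`, `QuotQuot₀Law` (D6 kills-form), `Quot₀RoofLaw` ((R-2)) + `DownReadings` (= `SpecReadings` + layer maps `isogW₀` + the four laws) — ONE interface at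
>   ED. 1 because the DEFINITIONS of `sp`∕`quot`∕`smap` need the schematic-closure vocabulary over `𝒪_Ω̄` (A-p03 (g30) organ (S-c); GEN Q4: typed HERE in §0 at ED. 2), and a
>   downstream stub taking `sp`∕`quot`∕`isogW₀` as FREE binders would be false as stated (perverse law-abiding readings break (b4′)∕D6∕the roof); ED. 2 re-cuts `stub_DOWN` into
>   `stub_SPEC`∕`stub_TWIST`∕`stub_LAYER`∕`stub_D6`∕`stub_ROOF` over those definitions (memo §3: 6 stubs).  Each law is its own `Prop` so no declaration elaborates the
>   dock tower twice (a flat `DownReadings` with the `isogW₀_ker` row inline exceeds 400 000 heartbeats at `whnf` — measured, bisection `isogW₀_hom` ✓ ∕ `isogW₀_ker` ✗).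
> * §0d PACKAGERS (sorry-free): `blockOf I 𝔡 𝔯 : BlockReading₀ …` (the 24 K-rows field-to-field from `𝔡`, `subEquiv := Equiv.refl`, `kerF_spec := rfl`, `isEtale_spec := Iff.rfl`,
>   layer rows ∕ (b4′) from `𝔯`) and `frobOf … : FrobReading₀ …`, each in its own budget; the head is `intro …; obtain` ×3 `; exact ⟨{33 fields}⟩`.
> * `stub_LINES` (G7; M): the generic readings `quotΩ`∕`translΩ` with `HeckeClause ∧ RoofLink ∧ RoofLink₂` — from (L4) `I.heckeRoofΩ` + ★ P6c §6 apparatus + (L1) `I.injΩ`.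
> * `stub_DOWN` (G8 ∕ G10 ∕ G11; L): `Nonempty (DownReadings …)` given the roof-linked generic readings and the frame guards `hunit hKc hdisj` (ROAD H: ★ HBT
>   `exists_line_quotΩ_quotΩ_eq_translΩ_of_hecke_of_hyperspecial` feeds its D6 clause; `inj₀` is consumed here, SP4); reads NO twist datum.
> * `stub_FROB` (G9 ∕ G12-twist ∕ (R-2); L; A-p03 (g30) pen, closer skeleton `StubFROB.closer.skeleton.v1.A-p03g30.lean` 7dd799c5): `∃ twistIdeal twistNorm frobIdeal`, the
>   `FrobReading₀` rows `frobIdeal_spec twistNorm_eq frob₀_cover quot₀_roof` + the guards `twistIdeal_coprime twistIdeal_ne_bot` — TWIST DATA EXISTENTIAL (v2): «`∀ I, I.twistNorm γ = q`»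
>   is FALSE IN TRUTH (rescaling junk `𝔞_γ ↦ (1+N)𝔞_γ`, `n_γ ↦ (1+N)²n_γ` preserves every `RGDInputsAt` ED. 2 law), so the pins `n_γ = q`∕`𝔭_w ∣ 𝔞_γ` must come through the interface
>   (A-p03 Q-FROB-1: spine ED. 3 laws `twistIdeal_frob`∕`twistNorm_frob`) before `twistIdeal := I.twistIdeal` can be read; until then the honest statement is existential.
> No instance ∕ notation ∕ private; budgets ≤ 400 000 scoped `in`; imports = the spine + HarnessLib.
> [cite: Liu2021, Prop. D.8 p. 135, pp. 136–138] [cite: HarrisTaylorAMS2001, §III.4, pp. 108–110] [cite: RapoportSmithlingZhang2020Diagonal, §4.1 p. 17; §4.3 (4.23) p. 21]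
> [cite: Tate1997FiniteFlatGroupSchemes, (3.7)] [cite: Shimura1998, §13.1 Thm. 1 (pp. 97–99)] [cite: Kottwitz1992, §5, pp. 390–391]
>
> ED. 3 «L1 FOLD» v2ns (cand, LA1-plan (g5) on LEAD «M-91» PLATE (a) — K3 planning input; D-LINE pen F0P6c-plan rules; = LA1-plan (g4) cand 2e732dbca03c2642 with ONE change:
> the folded organs live in the FRESH namespace `L1Fold`, not `StubLINES`): the L1 closer leaf `Lines/F0_P6a_StubLINES.lean` ED. 1 (a2cea14b7c1cc2df) body — organs
> `stub_REF` ∕ `stub_OLIFT` ∕ `stub_PACK` (all ★-paid, sorry-free) and head `stub_LINES_of_organs` — is pasted VERBATIM (leaf ll. 58–316) as §0e below under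
> `namespace L1Fold`, BEFORE `section Stubs`; the socket `stub_LINES` (statement TOKEN FOR TOKEN unchanged) is PAID IN-FILE `:= L1Fold.stub_LINES_of_organs I`, so this
> file's code-`sorry` count reads 2 {`stub_DOWN`, `stub_FROB`} and `--axioms stub_LINES` = TRIO.  FRESH NAMESPACE ⇒ NO FQN MOVES: the leaf ED. 1 (which declares
> `F0P6aDatumOfInputs.StubLINES.*` and imports this file) RE-MAKES UNCHANGED against this edition (no duplicate declarations), MAIN ED. 9՚s token
> `StubLINES.stub_LINES_of_organs` and its `import …Lines.F0_P6a_StubLINES` stay valid byte-for-byte, and NO leaf∕MAIN edition is needed in the same write block (the leaf may be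
> shimmed with an alias `StubLINES.stub_LINES_of_organs := L1Fold.stub_LINES_of_organs`, or MAIN re-pointed to the paid socket, in ANY LATER edition once this one is served).
> Imports = the spine + the leaf՚s three ★ modules + HarnessLib.
-/

/-! ### ED. 4 (K5-H2) WHAT MOVED ★-SIDE: ED. 3 ll. 79–748 — the §0 letters, `section Dock`, §0c–§0d readings∕laws∕packagers, §0e `L1Fold` organs (all sorry-free) — now live in
★ `Theorems/F0P6aDatumOfInputsDefs{Dock,Letters,Organs}.lean` (p852852 ∕ p852872 ∕ p852885) under THIS namespace, and ★ `Theorems/F0P6aDatumOfInputsDefs.lean` (LAST part, imported above) adds the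
socket TYPES `StubDOWNType`∕`StubFROBType`∕`DatumOfLineType` and the ★-shaped head `datum_of_inputs_star (hL : type_of% @L1Fold.stub_LINES_of_organs) (hD : StubDOWNType) (hF : StubFROBType)`
(§3★ there).  What STAYS here, BY FQN and byte-identical to ED. 3 (ll. 750–872, 874–1013): the PAID socket `stub_LINES` (BY TERM `:= L1Fold.stub_LINES_of_organs I` — it may NOT ride ★-side:
gate `dedup.landed`, a `Theorems/` theorem may not restate the importable ★ organ head) with its junction, the two `sorry` sockets `stub_DOWN`∕`stub_FROB` in the same `section Stubs` frame,
the head `datum_of_line`, the parametric head `datum_of_inputs` (MAIN `Lines/F0_P6a_ModuliDatum.lean` :654 reads it) and the ED. 2 junction; ADDED: ORDER certificates (each socket HAS its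
★ type) and JUNCTION both ways between `datum_of_inputs` and ★ `datum_of_inputs_star`. -/

set_option autoImplicit false

noncomputable section

namespace Summit.HodgeConjecture.HodgeConjecture.Cruxes.HLiu418.F0P6aDatumOfInputs

set_option linter.dupNamespace false  -- `Summit.HodgeConjecture.HodgeConjecture.…` BY DESIGN (D-0017)

open CategoryTheory CategoryTheory.Limits NumberField IsDedekindDomain MulAction
open scoped Matrix Polynomial Pointwise MonoidalCategory
open Literature.NumberTheory.GaloisRepresentations
open Literature.NumberTheory.Automorphic Literature.NumberTheory.Automorphic.UnitaryGroup
open Literature.AlgebraicGeometry.ShimuraVarieties.UnitaryCanonicalModel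
open Literature.NumberTheory.Automorphic.Liu2021.AppendixC
open Literature.AlgebraicGeometry.Motives (AlgPoints IntegralModel SchemeOver thickening thickeningGalAction thickeningLift specOver relFrobeniusOver frobeniusTwistOver)
open Literature.NumberTheory.DiophantineGeometry (geomResidueField specialFibreFunctor specResidueField)
open Literature.AlgebraicGeometry.RelativeSpec (ActionOver)
open Literature.NumberTheory.EllipticCurves (genericFibre)
open Literature.AlgebraicGeometry.GroupSchemes.AffineGroupScheme (Alg quotIncl)
open Summit.HodgeConjecture.HodgeConjecture.Cruxes.HLiu418.F0P6cDictConstructors (kerFI AdmSub IdealIsEtale isAdm_kerFI)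
open Summit.HodgeConjecture.HodgeConjecture.Cruxes.HLiu418.F0P6aModuliDatumDefs
open Summit.HodgeConjecture.HodgeConjecture.Cruxes.HLiu418.F0P6aRGDAssembly

/-! ### §1 THE REGISTERED STUBS -/

section Stubs

-- v3 (A4 self-test): the stubs carry the head՚s FRAME INSTANCES `[IsGalois ℚ F] [FiniteDimensional F Fi] [IsGalois F Fi] [Finite G]` (auto-included section instances):
-- (rL)՚s banal-block reading is an ideal-torsion law ONLY because no place over `p` is non-split once `w` is split, which is ★ `CMFieldGaloisPrimesOverSplit` under
-- `[IsGalois ℚ F]` BY NAME — over a non-Galois CM frame with an inert supersingular block `Ker F_q ∩ A[u^∞]` is no `A[𝔟_u]` and `Quot₀RoofLaw` would be false as stated.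

variable {F : Type} [Field F] [NumberField F] [IsCMField F] [IsGalois ℚ F] {ι₁ : F →+* ℂ}
    {Jstar : Matrix (Fin 2) (Fin 2) F}
    {K₀ : C5.OpenCompactSubgroup ↥(finAdelic ↥(maximalRealSubfield F) F (IsCMField.complexConj F) 2 Jstar)}
    {S : RecordSystemGS F Jstar ι₁ K₀} {hU7ₛ : S.HeckeTranslateDefinedOver}
    {hJ : (Jstar.map (IsCMField.complexConj F))ᵀ = Jstar} {hJu : IsUnit Jstar}
    {Fi : Type} [Field Fi] [Algebra F Fi] [FiniteDimensional F Fi] [IsGalois F Fi] {Kc : C5.SmallLevel K₀} {G : Type} [Group G] [Finite G]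
    {𝓜 : IntegralModel (𝓞 F) F ((thickening F Fi).obj (S.M.obj Kc))}
    {w : HeightOneSpectrum (𝓞 F)} {hw : (IsCMField.complexConj F) • w ≠ w} {h𝓨 : (𝓜.localise w).IsSmoothProper 1}
    {θ : ActionOver (𝓜.localise w).total.hom ((Fi ≃ₐ[F] Fi) × G)}
    {e : Fi →ₐ[F] AlgebraicClosure (w.adicCompletion F)}

/-- **`stub_LINES` (G7) — THE GENERIC READINGS WITH THE HECKE LAW AND THEIR ROOFS**: there are readings `quotΩ y L` (the right-`t₁(w)`-translate picked by the line `L`)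
and `translΩ y` (the `t₂`-translate) satisfying the DICT `hecke` law over `Line := LineOf I` and roof-linked to `y` as in (L4).  Why plausibly true: (L4) `I.heckeRoofΩ`
gives, for every presentation `(e′ := e, N′, rc₁, rc₂, x′)`, an injective `β ↦ H_β` onto the admissible subgroups (= `LineOf I (π x′)`) with the roofs; every `y` has a
presentation (★ `C5.SmallLevel.exists_normal_le_forall_heckeLE`, ★ `map_complexPoints_surjective` → `SchemeOver.exists_algPoints_comp_eq_of_surjective`); the reading is
presentation-independent because the roof neighbour through a kernel with prescribed `𝔭_{c•w}`-part is UNIQUE by (L1) `I.injΩ` (its tuple is pinned: the `w`-part of the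
kernel is the `λ`-annihilator of the `c•w`-part, clause (r3)); finite orbits ★ `isHeckeTriple_top_of_isCompact_isOpen`, uniqueness of translates ★ `heckeTranslate_unique`.
Size M. [cite: Liu2021, Prop. D.8 (1)(2) p. 135] [cite: HarrisTaylorAMS2001, §III.4, pp. 108–110] -/
theorem stub_LINES (I : RGDInputsAt F ι₁ Jstar K₀ S hU7ₛ hJ hJu Fi Kc G 𝓜 w hw h𝓨 θ e) :
    ∃ (quotΩ : ∀ y, LineOf I y → AlgPoints (S.M.obj Kc) (AlgebraicClosure (w.adicCompletion F)))
      (translΩ : AlgPoints (S.M.obj Kc) (AlgebraicClosure (w.adicCompletion F)) → AlgPoints (S.M.obj Kc) (AlgebraicClosure (w.adicCompletion F))),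
      HeckeClause I quotΩ translΩ ∧ RoofLink I quotΩ ∧ RoofLink₂ I translΩ :=
  L1Fold.stub_LINES_of_organs I   -- ED. 3 «L1 fold» v2ns: PAID IN-FILE (was `by sorry` in ED. 1∕2); organs §0e `namespace L1Fold`

/-- ED. 3 «L1 fold» v2ns JUNCTION (in-file): the head HAS the type of the socket, token for token (ex leaf §3). -/
example : type_of% @stub_LINES := @L1Fold.stub_LINES_of_organs

/-- **`stub_DOWN` (G8 ∕ G10 ∕ G11) — THE DOWNSTAIRS READINGS EXIST WITH THEIR LAWS**, given the dock `𝔡`, roof-linked generic readings satisfying the Hecke law,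
the frame law `_hθ` («`θ(τ,1)` is the Galois sheet action generically» — read by the SP5 rows `smap ∕ smap_kerF ∕ quot_smap`; v3) and MH՚s frame guards at `w` (`hunit`: `J⋆` is `w`-integral-unitary; `hKc`: `Kc` hyperspecial at `w ∣ v`; `hdisj`: special sheets disjoint).
Why plausibly true: SP4 — lifts of special points ★ `geomReductionMap_surjective_of_isSmoothProper`, `quot x̄ H := red₀ (quotΩ y L)` for a lift, WELL-DEFINED by (L1′) `I.inj₀`
applied to the reduced roofs (A-p03 census §2: ★ (ν6)(ν7), ★ `IsExactTwistPol.baseChange`, ★ `serreAction`, organ (G-q)); `sp` by schematic closure of `H_L ⊕ H_L^⊥` over `𝒪_Ω̄`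
read in `AdmSub (G₀ (red₀ y))` through `hkerG₀` (organ (S-c)); layer maps = the `c•w`-layer of the reduced quotient isogeny; D6 downstairs = ★ HBT
`exists_line_quotΩ_quotΩ_eq_translΩ_of_hecke_of_hyperspecial` (eats `HeckeClause` + `hunit` + `hKc`) + (H4′) «backtracking line = image line» + (H5) transfer by the red laws;
(b4′) = ★ `CanonicalLine.existsUnique_admK_spI_eq_kerFI`; SP5 by transport of admissible ideals along the group-scheme isomorphisms `θ(γ,1)_s`.  Reads NO twist datum
(junk-rescaling-proof, cf. `stub_FROB`).  Why it might fail: only through an orientation slip upstream (D4), then D6 is false on the `w`-block by an order count.  Size L; ED. 2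
re-cuts it four ways (memo §3).
[cite: Liu2021, Prop. D.8 p. 135, pp. 136–138] [cite: Tate1997FiniteFlatGroupSchemes, (3.7)] [cite: Carayol1986Compositio, §10.3 Prop. p. 211]
[cite: RapoportSmithlingZhang2020Diagonal, §4.3 (4.23) p. 21] [cite: Kottwitz1992, §5, p. 391] -/
theorem stub_DOWN (I : RGDInputsAt F ι₁ Jstar K₀ S hU7ₛ hJ hJu Fi Kc G 𝓜 w hw h𝓨 θ e) [ExpChar (geomResidueField w) I.pChar]
    (𝔡 : ∀ xbar, DockAt I xbar)
    (quotΩ : ∀ y, LineOf I y → AlgPoints (S.M.obj Kc) (AlgebraicClosure (w.adicCompletion F)))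
    (translΩ : AlgPoints (S.M.obj Kc) (AlgebraicClosure (w.adicCompletion F)) → AlgPoints (S.M.obj Kc) (AlgebraicClosure (w.adicCompletion F)))
    (_hhecke : HeckeClause I quotΩ translΩ) (_hroof : RoofLink I quotΩ) (_hroof₂ : RoofLink₂ I translΩ)
    (_hθ : ∀ γ : Fi ≃ₐ[F] Fi,
       (genericFibre (HeightOneSpectrum.valuationSubringAtPrime F w) F).map
             (Over.isoMk (θ.aut (γ, 1)) (θ.aut_comp (γ, 1))).hom ≫ (𝓜.localise w).genericIso'.hom
         = (𝓜.localise w).genericIso'.hom ≫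
             (Over.isoMk ((thickeningGalAction (L := Fi) (S.M.obj Kc)).aut γ)
               ((thickeningGalAction (L := Fi) (S.M.obj Kc)).aut_comp γ)).hom)
    (_hunit : (UnitaryGroup.isUnit_placeForm Jstar hJu w).unit ∈ glInt 2 (w.adicCompletion F))
    (_hKc : UnitaryGroup.IsHyperspecialAt ↥(maximalRealSubfield F) F (IsCMField.complexConj F) 2 Jstar Kc.1.1
      (w.under (𝓞 ↥(maximalRealSubfield F))))
    (_hdisj : haveI : AlgebraicGeometry.IsProper (𝓜.localise w).total.hom := h𝓨.2
      ∀ (β : Fi ≃ₐ[F] Fi) (P Q : AlgPoints (S.M.obj Kc) (AlgebraicClosure (w.adicCompletion F))),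
        (𝓜.localise w).geomReductionMap (thickeningLift e (S.M.obj Kc) P) =
          AlgPoints.map ((specialFibreFunctor w).map (Over.isoMk (θ.aut (β, 1)) (θ.aut_comp (β, 1))).hom :
              (𝓜.localise w).reductionAt ⟶ (𝓜.localise w).reductionAt)
            ((𝓜.localise w).geomReductionMap (thickeningLift e (S.M.obj Kc) Q)) → β = 1) :
    Nonempty (DownReadings I 𝔡 quotΩ translΩ) :=
  F0P6aStubDOWN.stub_DOWN_of_organs I 𝔡 quotΩ translΩ _hhecke _hroof _hroof₂ _hθ _hunit _hKc _hdisj   -- ED. 5 (P): PAID BY TERM from the ★ L2 leaf head (was `by sorry`, ED. 1–4; junction of record leaf :1978)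

set_option maxHeartbeats 400000 in
/-- **`stub_FROB` (G9 ∕ G12-twist ∕ (R-2); ED. 1 v2) — THE FROBENIUS PACKAGE WITH ITS TWIST DATA, EXISTENTIALLY: NORMALISED twist ideals `𝔞_γ` and norms `n_γ`, the co-ideals
`𝔠(γ)` (`𝔠(γ)𝔭_w = 𝔞_γ`, `n_γ = q` at a `γ` reading an arithmetic Frobenius on the sheet `e`), the FROBENIUS COVER `FrobCover₀ … (𝔞_γ) (n_γ) (red₀ (σ • y)) (red₀ y)`, the
guards `𝔞_γ ⊥ N`, `𝔞_γ ≠ 0` (the `ModuliDatum` fields `twistIdeal_coprime`∕`twistIdeal_ne_bot`, read by HFROB), and the DOWNSTAIRS ROOF `Quot₀RoofLaw … 𝔠` of the canonical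
translate** — given the dock, the roof-linked generic readings, the downstairs readings `𝔯` (for `sp`) and MH՚s frame guards.  WHY EXISTENTIAL (v1 → v2; A-p03 (g30) Q-FROB-1
sharpened): the rows `n_γ = q` ∕ `𝔭_w ∣ 𝔞_γ` are NOT PINNED by `RGDInputsAt` ED. 2 — worse, «`∀ I, … I.twistNorm γ = q`» is FALSE IN TRUTH: if `I` inhabits `RGDInputsAt` so does
its RESCALING `I′ := I` with `twistIdeal′ γ := (1+N)·𝔞_γ`, `twistNorm′ γ := (1+N)²·n_γ` (the (L5) covers `c ≫ ι(1+N)` satisfy (t1)–(t5) of `CoverΩ` — (t5) because `1+N ≡ 1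
(mod N)` fixes the level points —, `twistNorm_spec`, `twistIdeal_coprime`, `twistIdeal_ne_bot` all survive), and `n_γ = q` fails for one of `I`, `I′`.  So the D-line must
OUTPUT normalised twist data (true in truth: the arithmetic normalisation exists), and it can PAY them from `I` only once the spine carries the two ARITHMETIC LAWS at Frobenius-reading
`γ` (A-p03 Q-FROB-1: `RGDInputsAt` ED. 3 += `twistIdeal_frob : … → ∃ 𝔠, 𝔠 * w.asIdeal = twistIdeal γ` and `twistNorm_frob : … → twistNorm γ = pChar ^ fDeg`, paid by the P-line
from Shimura reciprocity ★ (C2-arith) p846565) — then `twistIdeal := I.twistIdeal`, `twistNorm := I.twistNorm`, the cover by reduction of (L5) `I.coverΩ` («reduction of the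
`σ`-conjugate = Frobenius twist of the reduction», ★ FROB-SHEET p845200, ★ Serre BC p846354), the roof by reduction of `RoofLink` + the congruence relation (rL) (Q-FROB-3: its own
leaf).  One stub because the cover and the roof read the SAME `𝔠(γ)`.  Closer skeleton: A-p03 (g30) `F0/P6/A-p03/g30/StubFROB.closer.skeleton.v1.A-p03g30.lean` 7dd799c5
(`frob₀_of_inputs`, stubs `stub_WDIV stub_WNORM stub_ROOF0 stub_COVER0`) re-typed over these carriers.  Why it might fail: only by the cover orientation ((f3)՚s scalar `n_γ⁻¹`).
Size L. [cite: Shimura1998, §13.1 Thm. 1 (pp. 97–99); §18.6 p. 127] [cite: SerreTate1968, Thm 1, Cor. 2] [cite: Liu2021, Prop. D.8 (3) p. 135, pp. 136–138]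
[cite: RapoportSmithlingZhang2020Diagonal, §3.2 p. 11, §4.3 (4.23) p. 21] -/
theorem stub_FROB (I : RGDInputsAt F ι₁ Jstar K₀ S hU7ₛ hJ hJu Fi Kc G 𝓜 w hw h𝓨 θ e) [ExpChar (geomResidueField w) I.pChar]
    (𝔡 : ∀ xbar, DockAt I xbar)
    (quotΩ : ∀ y, LineOf I y → AlgPoints (S.M.obj Kc) (AlgebraicClosure (w.adicCompletion F)))
    (translΩ : AlgPoints (S.M.obj Kc) (AlgebraicClosure (w.adicCompletion F)) → AlgPoints (S.M.obj Kc) (AlgebraicClosure (w.adicCompletion F)))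
    (_hhecke : HeckeClause I quotΩ translΩ) (_hroof : RoofLink I quotΩ) (_hroof₂ : RoofLink₂ I translΩ) (𝔯 : DownReadings I 𝔡 quotΩ translΩ)
    (_hunit : (UnitaryGroup.isUnit_placeForm Jstar hJu w).unit ∈ glInt 2 (w.adicCompletion F))
    (_hKc : UnitaryGroup.IsHyperspecialAt ↥(maximalRealSubfield F) F (IsCMField.complexConj F) 2 Jstar Kc.1.1
      (w.under (𝓞 ↥(maximalRealSubfield F))))
    (_hdisj : haveI : AlgebraicGeometry.IsProper (𝓜.localise w).total.hom := h𝓨.2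
      ∀ (β : Fi ≃ₐ[F] Fi) (P Q : AlgPoints (S.M.obj Kc) (AlgebraicClosure (w.adicCompletion F))),
        (𝓜.localise w).geomReductionMap (thickeningLift e (S.M.obj Kc) P) =
          AlgPoints.map ((specialFibreFunctor w).map (Over.isoMk (θ.aut (β, 1)) (θ.aut_comp (β, 1))).hom :
              (𝓜.localise w).reductionAt ⟶ (𝓜.localise w).reductionAt)
            ((𝓜.localise w).geomReductionMap (thickeningLift e (S.M.obj Kc) Q)) → β = 1) :
    ∃ (twistIdeal : (Fi ≃ₐ[F] Fi) → Ideal (𝓞 F)) (twistNorm : (Fi ≃ₐ[F] Fi) → ℕ) (frobIdeal : (Fi ≃ₐ[F] Fi) → Ideal (𝓞 F)),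
      (∀ (σ : Field.absoluteGaloisGroup (w.adicCompletion F)), IsAbsArithFrob σ → ∀ γ : Fi ≃ₐ[F] Fi,
        ((AlgEquiv.restrictScalars F (Field.absoluteGaloisGroup.toAlgEquiv (w.adicCompletion F) σ) :
            AlgebraicClosure (w.adicCompletion F) ≃ₐ[F] AlgebraicClosure (w.adicCompletion F)) :
            AlgebraicClosure (w.adicCompletion F) →ₐ[F] AlgebraicClosure (w.adicCompletion F)).comp e = e.comp (γ : Fi →ₐ[F] Fi) →
        frobIdeal γ * w.asIdeal = twistIdeal γ) ∧
      (∀ (σ : Field.absoluteGaloisGroup (w.adicCompletion F)), IsAbsArithFrob σ → ∀ γ : Fi ≃ₐ[F] Fi,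
        ((AlgEquiv.restrictScalars F (Field.absoluteGaloisGroup.toAlgEquiv (w.adicCompletion F) σ) :
            AlgebraicClosure (w.adicCompletion F) ≃ₐ[F] AlgebraicClosure (w.adicCompletion F)) :
            AlgebraicClosure (w.adicCompletion F) →ₐ[F] AlgebraicClosure (w.adicCompletion F)).comp e = e.comp (γ : Fi →ₐ[F] Fi) →
        twistNorm γ = I.pChar ^ I.fDeg) ∧
      (∀ (σ : Field.absoluteGaloisGroup (w.adicCompletion F)), IsAbsArithFrob σ → ∀ γ : Fi ≃ₐ[F] Fi,
        ((AlgEquiv.restrictScalars F (Field.absoluteGaloisGroup.toAlgEquiv (w.adicCompletion F) σ) :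
            AlgebraicClosure (w.adicCompletion F) ≃ₐ[F] AlgebraicClosure (w.adicCompletion F)) :
            AlgebraicClosure (w.adicCompletion F) →ₐ[F] AlgebraicClosure (w.adicCompletion F)).comp e = e.comp (γ : Fi →ₐ[F] Fi) →
        ∀ y : AlgPoints (S.M.obj Kc) (AlgebraicClosure (w.adicCompletion F)),
          FrobCover₀ 𝓜 w I.univ I.act I.dual I.pol I.lvl I.pChar I.fDeg (twistIdeal γ) (twistNorm γ)
            (red₀Of S Kc 𝓜 w h𝓨 e (σ • y)) (red₀Of S Kc 𝓜 w h𝓨 e y)) ∧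
      (∀ γ : Fi ≃ₐ[F] Fi, twistIdeal γ ⊔ Ideal.span {((I.N : ℕ) : 𝓞 F)} = ⊤) ∧
      (∀ γ : Fi ≃ₐ[F] Fi, twistIdeal γ ≠ ⊥) ∧
      Quot₀RoofLaw I 𝔡 quotΩ 𝔯.spec.sp frobIdeal :=
  F0P6aStubFROB.stubFROB_of_parts I 𝔡 quotΩ translΩ _hhecke _hroof _hroof₂ 𝔯 _hunit _hKc _hdisj   -- ED. 5 (P): PAID BY TERM from the ★ L3 leaf head (was `by sorry`, ED. 1–4; junction of record leaf :516)

end Stubs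

/-! #### ED. 4 ORDER CERTIFICATES — each ★ socket type IS the type of the live socket, binder for binder (plain terms; `@` keeps the implicit frame un-inserted). -/

set_option maxHeartbeats 400000 in
/-- ORDER CERTIFICATE (ED. 4): ★ `StubDOWNType` is the type of the socket `stub_DOWN`. -/
example : StubDOWNType := @stub_DOWN

set_option maxHeartbeats 400000 in
/-- ORDER CERTIFICATE (ED. 4): ★ `StubFROBType` is the type of the socket `stub_FROB`. -/
example : StubFROBType := @stub_FROB


/-! ### §2 THE HEAD: `datum_of_line` = the type of the spine socket `stub_DATUM`, TOKEN FOR TOKEN, sorry-free over the stubs -/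

set_option maxHeartbeats 400000 in
/-- **HEAD `datum_of_line`** — the spine socket `stub_DATUM` (`Lines/F0_P6a_RGDAssembly.lean` ED. 2 :333) TOKEN FOR TOKEN: at MH՚s inner binders, from the localised PEL
inputs `I : RGDInputsAt …` the moduli datum `ModuliDatum …` is inhabited.  ASSEMBLY (sorry-free over `stub_LINES`, `stub_DOWN`, `stub_FROB`): tuple, scalars and `inj₀` COPIED
from `I` (G1–G4; (L1′) `inj₀ := I.inj₀`); the dock `𝔡 x̄` from `nonempty_dockData` (spine §4 = ★ P6d) by ONE choice; carriers BY CONSTRUCTION (G5: `subEquiv := Equiv.refl`,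
`kerF_spec := rfl`, `isEtale_spec := Iff.rfl`); generic readings + `hecke` from `stub_LINES`; the downstairs readings and their laws from `stub_DOWN`; the NORMALISED twist data
`twistIdeal twistNorm` with `twistIdeal_coprime twistIdeal_ne_bot`, the co-ideals and the Frobenius cover ∕ roof from `stub_FROB` (v2: existential — `I.twistNorm γ = q` is not a law
of `RGDInputsAt` ED. 2 and is false for rescaled inhabitants); `block₀`∕`frob₀` packaged by `blockOf`∕`frobOf`.
[cite: Liu2021, Prop. D.8 p. 135, pp. 136–138] [cite: RapoportSmithlingZhang2020Diagonal, §4.1 Thm. 4.1 p. 17] [cite: Kottwitz1992, §5 pp. 389–391] -/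
theorem datum_of_line : ∀ (F : Type) [Field F] [NumberField F] [IsCMField F] [IsGalois ℚ F] (ι₁ : F →+* ℂ)
    (Jstar : Matrix (Fin 2) (Fin 2) F)
    (K₀ : C5.OpenCompactSubgroup ↥(finAdelic ↥(maximalRealSubfield F) F (IsCMField.complexConj F) 2 Jstar))
    (S : RecordSystemGS F Jstar ι₁ K₀) (hU7ₛ : S.HeckeTranslateDefinedOver)
    (hJ : (Jstar.map (IsCMField.complexConj F))ᵀ = Jstar) (hJu : IsUnit Jstar)
    (Fi : Type) [Field Fi] [Algebra F Fi] [FiniteDimensional F Fi] [IsGalois F Fi]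
    (Kc : C5.SmallLevel K₀) (G : Type) [Group G] [Finite G]
    (𝓜 : IntegralModel (𝓞 F) F ((thickening F Fi).obj (S.M.obj Kc)))
    (w : HeightOneSpectrum (𝓞 F)) (hw : (IsCMField.complexConj F) • w ≠ w) (h𝓨 : (𝓜.localise w).IsSmoothProper 1)
    (θ : ActionOver (𝓜.localise w).total.hom ((Fi ≃ₐ[F] Fi) × G))
    (_hθ : ∀ γ : Fi ≃ₐ[F] Fi,
       (genericFibre (HeightOneSpectrum.valuationSubringAtPrime F w) F).map
             (Over.isoMk (θ.aut (γ, 1)) (θ.aut_comp (γ, 1))).hom ≫ (𝓜.localise w).genericIso'.hom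
         = (𝓜.localise w).genericIso'.hom ≫
             (Over.isoMk ((thickeningGalAction (L := Fi) (S.M.obj Kc)).aut γ)
               ((thickeningGalAction (L := Fi) (S.M.obj Kc)).aut_comp γ)).hom)
    (e : Fi →ₐ[F] AlgebraicClosure (w.adicCompletion F))
    (_hunit : (UnitaryGroup.isUnit_placeForm Jstar hJu w).unit ∈ glInt 2 (w.adicCompletion F))
    (_hKc : UnitaryGroup.IsHyperspecialAt ↥(maximalRealSubfield F) F (IsCMField.complexConj F) 2 Jstar Kc.1.1
      (w.under (𝓞 ↥(maximalRealSubfield F))))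
    (_hdisj : haveI : AlgebraicGeometry.IsProper (𝓜.localise w).total.hom := h𝓨.2
      ∀ (β : Fi ≃ₐ[F] Fi) (P Q : AlgPoints (S.M.obj Kc) (AlgebraicClosure (w.adicCompletion F))),
        (𝓜.localise w).geomReductionMap (thickeningLift e (S.M.obj Kc) P) =
          AlgPoints.map ((specialFibreFunctor w).map (Over.isoMk (θ.aut (β, 1)) (θ.aut_comp (β, 1))).hom :
              (𝓜.localise w).reductionAt ⟶ (𝓜.localise w).reductionAt)
            ((𝓜.localise w).geomReductionMap (thickeningLift e (S.M.obj Kc) Q)) → β = 1),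
    RGDInputsAt F ι₁ Jstar K₀ S hU7ₛ hJ hJu Fi Kc G 𝓜 w hw h𝓨 θ e →
      Nonempty (ModuliDatum F ι₁ Jstar K₀ S hU7ₛ hJ hJu Fi Kc G 𝓜 w hw h𝓨 θ e) := by
  intro F _ _ _ _ ι₁ Jstar K₀ S hU7ₛ hJ hJu Fi _ _ _ _ Kc G _ _ 𝓜 w hw h𝓨 θ hθ e hunit hKc hdisj I
  classical
  haveI : CharP (geomResidueField w) I.pChar := I.charP₀
  haveI : ExpChar (geomResidueField w) I.pChar := ExpChar.prime I.hpChar.1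
  have 𝔡 : ∀ xbar, DockAt I xbar := fun xbar => Classical.choice (nonempty_dockAt I xbar)
  obtain ⟨quotΩ, translΩ, hhecke, hroof, hroof₂⟩ := stub_LINES I
  obtain ⟨𝔯⟩ := stub_DOWN I 𝔡 quotΩ translΩ hhecke hroof hroof₂ hθ hunit hKc hdisj
  obtain ⟨twistIdeal, twistNorm, frobIdeal, hfrobIdeal, htwistNorm, hcover, hcoprime, hnebot, hroof₀⟩ :=
    stub_FROB I 𝔡 quotΩ translΩ hhecke hroof hroof₂ 𝔯 hunit hKc hdisj
  exact ⟨{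
    Line := LineOf I
    Sub := SubOf I 𝔡
    kerF := kerFOf I 𝔡
    IsEtale := fun {_} H => IsEtaleOf I 𝔡 H
    quotΩ := quotΩ
    translΩ := translΩ
    quot := 𝔯.spec.quot
    transl := 𝔯.spec.transl
    sp := 𝔯.spec.sp
    hecke := hhecke
    red_quotΩ := 𝔯.spec.red_quotΩ
    red_translΩ := 𝔯.spec.red_translΩ
    smap := 𝔯.spec.smap
    smap_kerF := 𝔯.spec.smap_kerF
    quot_smap := 𝔯.spec.quot_smap
    univ := I.univ
    act := I.act
    dual := I.dual
    pol := I.pol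
    g := I.g
    N := I.N
    lvl := I.lvl
    inj₀ := I.inj₀
    twistIdeal := twistIdeal
    twistIdeal_coprime := hcoprime
    twistIdeal_ne_bot := hnebot
    pChar := I.pChar
    hpChar := I.hpChar
    twistNorm := twistNorm
    fDeg := I.fDeg
    charP₀ := I.charP₀
    block₀ := blockOf I 𝔡 𝔯
    frob₀ := frobOf I 𝔡 𝔯 hfrobIdeal htwistNorm hcover hroof₀ }⟩

/-! ### §3 THE PARAMETRIC HEAD (ED. 2, ADD-ONLY; LEAD F0P6-plan (g3) «M-59» (2)): `datum_of_inputs hL hD hF` = `datum_of_line` with the three stubs as HYPOTHESES -/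

set_option maxHeartbeats 400000 in
/-- **PARAMETRIC HEAD `datum_of_inputs`** (ED. 2, ADD-ONLY — every ED. 1 declaration above is byte-identical; LEAD F0P6-plan (g3) «M-59» (2)): the type of the spine
socket `stub_DATUM` (= `type_of% @datum_of_line`) from the THREE STUB TYPES AS HYPOTHESES `hL : type_of% @stub_LINES`, `hD : type_of% @stub_DOWN`,
`hF : type_of% @stub_FROB` — the body of `datum_of_line` :619 ff. VERBATIM with the three calls `stub_LINES I` ∕ `stub_DOWN I …` ∕ `stub_FROB I …` replaced by `hL I` ∕
`hD I …` ∕ `hF I …`.  PURPOSE (closing topology): main ED. 7∕8 sets `stub_RGD := rgd_of_inputs (…) (datum_of_inputs StubLINES.stub_LINES_of_organs stub_DOWN stub_FROB)`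
importing the closer leaves (`Lines/F0_P6a_StubLINES.lean` L1, then the L2∕L3 closers), so each stub leaves the cone BY IMPORT without touching its socket here; this
head is SORRY-FREE and its `--axioms` are {propext, Classical.choice, Quot.sound} (no `sorryAx`: the stubs are not called).
[cite: Liu2021, Prop. D.8 p. 135, pp. 136–138] [cite: RapoportSmithlingZhang2020Diagonal, §4.1 Thm. 4.1 p. 17] [cite: Kottwitz1992, §5 pp. 389–391] -/
theorem datum_of_inputs (hL : type_of% @stub_LINES) (hD : type_of% @stub_DOWN) (hF : type_of% @stub_FROB) : type_of% @datum_of_line := by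
  intro F _ _ _ _ ι₁ Jstar K₀ S hU7ₛ hJ hJu Fi _ _ _ _ Kc G _ _ 𝓜 w hw h𝓨 θ hθ e hunit hKc hdisj I
  classical
  haveI : CharP (geomResidueField w) I.pChar := I.charP₀
  haveI : ExpChar (geomResidueField w) I.pChar := ExpChar.prime I.hpChar.1
  have 𝔡 : ∀ xbar, DockAt I xbar := fun xbar => Classical.choice (nonempty_dockAt I xbar)
  obtain ⟨quotΩ, translΩ, hhecke, hroof, hroof₂⟩ := hL I
  obtain ⟨𝔯⟩ := hD I 𝔡 quotΩ translΩ hhecke hroof hroof₂ hθ hunit hKc hdisj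
  obtain ⟨twistIdeal, twistNorm, frobIdeal, hfrobIdeal, htwistNorm, hcover, hcoprime, hnebot, hroof₀⟩ :=
    hF I 𝔡 quotΩ translΩ hhecke hroof hroof₂ 𝔯 hunit hKc hdisj
  exact ⟨{
    Line := LineOf I
    Sub := SubOf I 𝔡
    kerF := kerFOf I 𝔡
    IsEtale := fun {_} H => IsEtaleOf I 𝔡 H
    quotΩ := quotΩ
    translΩ := translΩ
    quot := 𝔯.spec.quot
    transl := 𝔯.spec.transl
    sp := 𝔯.spec.sp
    hecke := hhecke
    red_quotΩ := 𝔯.spec.red_quotΩ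
    red_translΩ := 𝔯.spec.red_translΩ
    smap := 𝔯.spec.smap
    smap_kerF := 𝔯.spec.smap_kerF
    quot_smap := 𝔯.spec.quot_smap
    univ := I.univ
    act := I.act
    dual := I.dual
    pol := I.pol
    g := I.g
    N := I.N
    lvl := I.lvl
    inj₀ := I.inj₀
    twistIdeal := twistIdeal
    twistIdeal_coprime := hcoprime
    twistIdeal_ne_bot := hnebot
    pChar := I.pChar
    hpChar := I.hpChar
    twistNorm := twistNorm
    fDeg := I.fDeg
    charP₀ := I.charP₀
    block₀ := blockOf I 𝔡 𝔯
    frob₀ := frobOf I 𝔡 𝔯 hfrobIdeal htwistNorm hcover hroof₀ }⟩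

/-- JUNCTION (ED. 2): the ED. 1 head IS the parametric head at the three registered stubs (kernel-checked `example`; ED. 5 (P): sorry-free — all three stubs are paid).
[cite: Liu2021, Prop. D.8 p. 135] -/
example : type_of% @datum_of_line := datum_of_inputs stub_LINES stub_DOWN stub_FROB

set_option maxHeartbeats 400000 in
/-- ORDER CERTIFICATE (ED. 4): ★ `DatumOfLineType` is the type of the head `datum_of_line`. -/
example : DatumOfLineType := datum_of_line

/-! #### ED. 4 JUNCTION BOTH WAYS — the ★-shaped head HAS the type of `datum_of_inputs` and conversely; and the ED. 1 head՚s type from the ★ head at the live sockets. -/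

set_option maxHeartbeats 400000 in
/-- JUNCTION (★ → hub, ED. 4): ★ `datum_of_inputs_star` at the type of `datum_of_inputs`. -/
example : type_of% @datum_of_inputs := @datum_of_inputs_star

set_option maxHeartbeats 400000 in
/-- JUNCTION (hub → ★, ED. 4): `datum_of_inputs` at the type of ★ `datum_of_inputs_star`. -/
example : type_of% @datum_of_inputs_star := @datum_of_inputs

set_option maxHeartbeats 400000 in
/-- JUNCTION (ED. 4) at the live sockets through the ★ head (`@`: the expected types are `def`s, so no implicit-lambda is inserted; ED. 5 (P): sorry-free — the sockets are paid). -/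
example : DatumOfLineType := datum_of_inputs_star @stub_LINES @stub_DOWN @stub_FROB

end Summit.HodgeConjecture.HodgeConjecture.Cruxes.HLiu418.F0P6aDatumOfInputs

end
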